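import Summits.AnomalousDissipation.AnomalousDissipation.Theorems.SteadyMirrorGateMirrorSteadyExistenceTGSymmetry

/-!
# Routes SteadyMirrorGate / PumpSignGate — support `MirrorSteadyExistenceTG` (stmt-AnomalousDissipation-28078): part 2 of 3

Part 2 of the lens-6 g57 kernel K4: §3 the symmetric stationary Galerkin sequence (Temam 1979, Ch. II §1, (1.25)–(1.30), in `W_N`).
Namespace `…Theorems.MirrorSteadyExistence`; declarations byte-identical to K4; imports part 1. [cite: Temam1979, Ch. II §1] [folklore]
-/

noncomputable section

-- every `Summit.AnomalousDissipation.AnomalousDissipation.…` name repeats the summit = sub-problem segment (D-0017 layout)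
set_option linter.dupNamespace false

namespace Summit.AnomalousDissipation.AnomalousDissipation.Theorems

open MeasureTheory Filter Topology Set UnitAddTorus
open scoped ENNReal NNReal InnerProductSpace
open Literature.Analysis.FunctionSpaces Literature.Analysis.FluidPDE

namespace MirrorSteadyExistence

-- §1 symmetry engine shared with the tree module `EnsembleRigidityGPMeanBoundedFamilyStubSymmetricScheme` (census g17 dedup, see part 1)
open Summit.AnomalousDissipation.AnomalousDissipation.Theorems.EnsembleRigidity.GPMeanBoundedFamily.StubSymmetricScheme

/-! ## §3 The symmetric stationary Galerkin sequence (Temam 1979, Ch. II §1, (1.25)–(1.30), in `W_N`) -/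

section Galerkin

open Literature.Analysis.FunctionSpaces.Torus Literature.Analysis.FluidPDE.Torus

variable {d : Type*} [Fintype d] [DecidableEq d]

/-- **Symmetric stationary Galerkin approximations** (the tree's `exists_steady_galerkin_approx` run in the
symmetric subspace `W_N = galerkinSubspace S_N ⊓ {ĉ(Qk) = e_{−Qk}(b) Q ĉ(k), A ∈ G}`, `S_N = {0 < |k|² ≤ N²}`):
for `ν > 0`, a smooth force `f` covariant under a finite list `G` of affine lattice symmetries, and `N ∈ ℕ`,
there is a conjugate-symmetric transversal coefficient family `C` supported in `S_N` with Temam's a priori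
bound `(4π²ν)² ∑ |k|² ‖C k‖² ≤ ∫ ‖f‖²`, whose field `u = realTrigPoly S_N C` solves the tested Galerkin equations
against every smooth divergence-free `a` band-limited to `S_N` and is covariant under every `A ∈ G`.
[cite: Temam1979, Ch. II Thm. 1.2 (proof, (1.25)–(1.30))] -/
theorem exists_symmetric_steady_galerkin_approx {ν : ℝ} (hν : 0 < ν)
    (G : List (Equiv.Perm d × (d → ℤ) × UnitAddTorus d))
    (hG : ∀ p ∈ G, ∀ j, p.2.1 j = 1 ∨ p.2.1 j = -1) {f : UnitAddTorus d → EuclideanSpace ℝ d}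
    (hf : IsSmooth f) (hfG : ∀ p ∈ G, ∀ (y : UnitAddTorus d) (i : d),
      f (fun j => p.2.1 j • y (p.1 j) + p.2.2 j) i = (p.2.1 i : ℝ) * f y (p.1 i)) (N : ℕ) :
    ∃ C : (d → ℤ) → EuclideanSpace ℂ d,
      IsConjSymm C ∧ (∀ k, ∑ j, (k j : ℂ) * C k j = 0) ∧
      (∀ k ∉ (freqBall (d := d) N).erase 0, C k = 0) ∧
      (4 * Real.pi ^ 2 * ν) ^ 2 *
          (∑ k ∈ (freqBall (d := d) N).erase 0, freqNormSq k * ‖C k‖ ^ 2) ≤ ∫ x, ‖f x‖ ^ 2 ∧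
      (∀ a : UnitAddTorus d → EuclideanSpace ℝ d, IsSmooth a → IsDivFree a →
        (∀ k ∉ (freqBall (d := d) N).erase 0, mFourierCoeff (EuclideanSpace.complexify ∘ a) k = 0) →
        ∫ x, (⟪realTrigPoly ((freqBall (d := d) N).erase 0) C x,
            Literature.Analysis.FunctionSpaces.Torus.convect (realTrigPoly ((freqBall (d := d) N).erase 0) C) a x⟫_ℝ +
          ν * ⟪realTrigPoly ((freqBall (d := d) N).erase 0) C x,
            Literature.Analysis.FunctionSpaces.Torus.laplacian a x⟫_ℝ +
          ⟪f x, a x⟫_ℝ) = 0) ∧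
      ∀ p ∈ G, ∀ (y : UnitAddTorus d) (i : d),
        realTrigPoly ((freqBall (d := d) N).erase 0) C (fun j => p.2.1 j • y (p.1 j) + p.2.2 j) i =
          (p.2.1 i : ℝ) * realTrigPoly ((freqBall (d := d) N).erase 0) C y (p.1 i) := by
  set S : Finset (d → ℤ) := (freqBall (d := d) N).erase 0 with hSdef
  have hS : ∀ k ∈ S, -k ∈ S := neg_mem_freqBall_erase_zero
  have hS0 : (0 : d → ℤ) ∉ S := by simp [hSdef]
  have hf2 : MemLp f 2 volume := hf.memLp 2
  have hfi : Integrable f volume := hf2.integrable one_le_two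
  -- `S` is stable under every `Q`
  have hSQ : ∀ p ∈ G, ∀ k : d → ℤ, (fun j => p.2.1 j * k (p.1 j)) ∈ S ↔ k ∈ S := by
    intro p hp k
    rw [hSdef, Finset.mem_erase, Finset.mem_erase, mem_freqBall, mem_freqBall,
      freqNormSq_signedPerm p.1 (hG p hp) (Q := fun k j => p.2.1 j * k (p.1 j)) (fun _ _ => rfl),
      ne_eq, ne_eq,
      signedPerm_eq_zero_iff p.1 (hG p hp) (Q := fun k j => p.2.1 j * k (p.1 j)) (fun _ _ => rfl)]
  have hφ : ∀ p ∈ G, ∀ l m : d → ℤ, mFourier (-fun j => p.2.1 j * (l + m) (p.1 j)) p.2.2 =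
      mFourier (-fun j => p.2.1 j * l (p.1 j)) p.2.2 *
        mFourier (-fun j => p.2.1 j * m (p.1 j)) p.2.2 := by
    intro p _ l m
    rw [← mFourier_add]
    exact congrArg (mFourier · p.2.2) (funext fun j => by simp only [Pi.neg_apply, Pi.add_apply]; ring)
  -- the force coefficients `f̂|_S`: real, and their extension by zero is covariant
  set g : ↥S → EuclideanSpace ℂ d := fun k =>
    mFourierCoeff (EuclideanSpace.complexify ∘ f) (k : d → ℤ) with hgdef
  have hgr : IsRealCoeff g := isRealCoeff_mFourierCoeff hfi
  have hgfix : ∀ p ∈ G, ∀ (k : d → ℤ) (i : d),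
      coeffExt S g (fun j => p.2.1 j * k (p.1 j)) i = mFourier (-fun j =>
        p.2.1 j * k (p.1 j)) p.2.2 * ((p.2.1 i : ℂ) * coeffExt S g k (p.1 i)) := by
    intro p hp k i
    by_cases hk : k ∈ S
    · rw [coeffExt_of_mem _ ((hSQ p hp k).2 hk), coeffExt_of_mem _ hk]
      exact mFourierCoeff_of_symmetric p.1 (hG p hp) (fun _ _ => rfl) p.2.2 hf.continuous (hfG p hp)
        k i
    · rw [coeffExt_of_not_mem _ (fun h => hk ((hSQ p hp k).1 h)), coeffExt_of_not_mem _ hk]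
      simp
  -- the symmetric subspace of the Galerkin phase space, invariant under the Galerkin field
  let W : Submodule ℝ (↥S → EuclideanSpace ℂ d) :=
    { carrier := {c | c ∈ galerkinSubspace S ∧ ∀ p ∈ G, ∀ (k : d → ℤ) (i : d),
        coeffExt S c (fun j => p.2.1 j * k (p.1 j)) i = mFourier (-fun j =>
          p.2.1 j * k (p.1 j)) p.2.2 * ((p.2.1 i : ℂ) * coeffExt S c k (p.1 i))}
      zero_mem' := ⟨Submodule.zero_mem _, fun p _ k i => by simp⟩
      add_mem' := fun {c c'} hc hc' => ⟨Submodule.add_mem _ hc.1 hc'.1, fun p hp k i => by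
        rw [coeffExt_add, Pi.add_apply, PiLp.add_apply, Pi.add_apply, PiLp.add_apply,
          hc.2 p hp k i, hc'.2 p hp k i]
        ring⟩
      smul_mem' := fun a c hc => ⟨Submodule.smul_mem _ a hc.1, fun p hp k i => by
        rw [coeffExt_smul, Pi.smul_apply, PiLp.smul_apply, Pi.smul_apply, PiLp.smul_apply,
          hc.2 p hp k i]
        simp only [Complex.real_smul]
        ring⟩ }
  have hWle : W ≤ galerkinSubspace S := fun c hc => hc.1
  have hWinv : ∀ c ∈ W, galerkinRHS S ν g c ∈ W := by
    intro c hc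
    refine ⟨galerkinRHS_mem ν hS hgr hc.1, fun p hp k i => ?_⟩
    by_cases hk : k ∈ S
    · rw [coeffExt_of_mem _ ((hSQ p hp k).2 hk), coeffExt_of_mem _ hk,
        galerkinRHS_apply, galerkinRHS_apply]
      exact galerkinField_signedPerm p.1 (hG p hp) (fun _ _ => rfl) ν (hSQ p hp) (hφ p hp)
        (hgfix p hp) (hc.2 p hp) k i
    · rw [coeffExt_of_not_mem _ (fun h => hk ((hSQ p hp k).1 h)), coeffExt_of_not_mem _ hk]
      simp
  -- a stationary Galerkin solution in `W`
  obtain ⟨c, hcW, h0⟩ := exists_galerkinRHS_eq_zero_of_invariant hν hS hS0 hgr W hWle hWinv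
  have hc : c ∈ galerkinSubspace S := hWle hcW
  have hCsymm : IsConjSymm (coeffExt S c) := hc.1.isConjSymm_coeffExt hS
  have hCT : IsTransversal S (coeffExt S c) := hc.2.isTransversal_coeffExt
  have hGg : realTrigPoly S (coeffExt S g) =
      realTrigPoly S fun k => mFourierCoeff (EuclideanSpace.complexify ∘ f) k :=
    realTrigPoly_coeffExt_restrict _
  refine ⟨coeffExt S c, hCsymm, ?_, fun k hk => coeffExt_of_not_mem c hk, ?_, ?_, ?_⟩
  · intro k
    by_cases hk : k ∈ S
    · exact hCT k hk
    · simp [coeffExt_of_not_mem c hk]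
  · -- a priori bound
    have h1 := sum_freqNormSq_mul_norm_sq_le_of_galerkinRHS_eq_zero hν hS hS0 hgr hc h0
    rw [← sum_coeffExt (fun k v => freqNormSq k * ‖v‖ ^ 2) c] at h1
    refine h1.trans ?_
    calc ∑ k : ↥S, ‖g k‖ ^ 2
        = ∑ k ∈ S, ‖mFourierCoeff (EuclideanSpace.complexify ∘ f) k‖ ^ 2 :=
          Finset.sum_coe_sort S fun k => ‖mFourierCoeff (EuclideanSpace.complexify ∘ f) k‖ ^ 2
      _ ≤ ∫ x, ‖f x‖ ^ 2 :=
          sum_le_hasSum S (fun k _ => sq_nonneg _) (hasSum_sq_norm_mFourierCoeff_complexify hf2)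
  · -- the tested Galerkin equations
    intro a ha hdiv hband
    have hid := sum_re_inner_galerkinField_test ν hS (hgr.isConjSymm_coeffExt hS) hCsymm hCT ha
      hdiv hband
    have hzero : ∑ k ∈ S, (inner ℂ (galerkinField ν S (coeffExt S g) (coeffExt S c) k)
        (mFourierCoeff (EuclideanSpace.complexify ∘ a) k)).re = 0 := by
      refine Finset.sum_eq_zero fun k hk => ?_
      have hk0 : galerkinField ν S (coeffExt S g) (coeffExt S c) k = 0 := by
        have := congrFun h0 ⟨k, hk⟩
        rwa [galerkinRHS_apply] at this
      rw [hk0, inner_zero_left, Complex.zero_re]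
    rw [hzero, hGg] at hid
    -- split off the force term and rewrite it by Parseval
    have hu : IsSmooth (realTrigPoly S (coeffExt S c)) := isSmooth_realTrigPoly _ _
    have hGs : IsSmooth (realTrigPoly S fun k => mFourierCoeff (EuclideanSpace.complexify ∘ f) k) :=
      isSmooth_realTrigPoly _ _
    have i1 : Integrable (fun x => ⟪realTrigPoly S (coeffExt S c) x,
        Literature.Analysis.FunctionSpaces.Torus.convect (realTrigPoly S (coeffExt S c)) a x⟫_ℝ +
        ν * ⟪realTrigPoly S (coeffExt S c) x, Literature.Analysis.FunctionSpaces.Torus.laplacian a x⟫_ℝ) volume :=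
      ((hu.continuous.inner (hu.convect ha).continuous).add
        ((hu.continuous.inner ha.laplacian.continuous).const_smul ν)).integrable_unitAddTorus
    have i2 : Integrable (fun x => ⟪realTrigPoly S
        (fun k => mFourierCoeff (EuclideanSpace.complexify ∘ f) k) x, a x⟫_ℝ) volume :=
      (hGs.continuous.inner ha.continuous).integrable_unitAddTorus
    have i3 : Integrable (fun x => ⟪f x, a x⟫_ℝ) volume :=
      integrable_inner_of_continuous hfi ha.continuous
    have hforce := integral_inner_realTrigPoly_mFourierCoeff_eq hS hf2
      (ha.continuous.memLp_of_hasCompactSupport (HasCompactSupport.of_compactSpace _)) hband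
    rw [integral_add i1 i2, hforce, ← integral_add i1 i3] at hid
    exact hid.symm
  · -- covariance of the approximation: its coefficients are `coeffExt S c`, in `W`
    intro p hp y i
    refine symmetric_of_mFourierCoeff p.1 (hG p hp) (fun _ _ => rfl) p.2.2
      (continuous_realTrigPoly _ _) (fun k i => ?_) y i
    have hcoef : ∀ k : d → ℤ, mFourierCoeff (EuclideanSpace.complexify ∘
        realTrigPoly S (coeffExt S c)) k = coeffExt S c k := fun k => by
      rw [mFourierCoeff_realTrigPoly hS hCsymm]
      by_cases hk : k ∈ S
      · rw [if_pos hk]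
      · rw [if_neg hk, coeffExt_of_not_mem _ hk]
    rw [hcoef, hcoef]
    exact hcW.2 p hp k i

/-- **The symmetric stationary Galerkin sequence** (`exists_symmetric_steady_galerkin_approx` and the tree's
`steady_galerkin_bounds`, repackaged as vector fields exactly as `exists_steady_galerkin_sequence`): smooth
divergence-free mean-zero `G`-covariant fields `U N` with `‖∇U N‖² ≤ 4π²Λ`, `∫ ‖U N‖² ≤ Λ`,
`Λ = (∫ ‖f‖²)/(4π²ν)²`, solving the tested Galerkin equations on `S_N`.
[cite: Temam1979, Ch. II Thm. 1.2 (proof, (1.25)–(1.30))] -/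
theorem exists_symmetric_steady_galerkin_sequence {ν : ℝ} (hν : 0 < ν)
    (G : List (Equiv.Perm d × (d → ℤ) × UnitAddTorus d))
    (hG : ∀ p ∈ G, ∀ j, p.2.1 j = 1 ∨ p.2.1 j = -1) {f : UnitAddTorus d → EuclideanSpace ℝ d}
    (hf : IsSmooth f) (hfG : ∀ p ∈ G, ∀ (y : UnitAddTorus d) (i : d),
      f (fun j => p.2.1 j • y (p.1 j) + p.2.2 j) i = (p.2.1 i : ℝ) * f y (p.1 i)) :
    ∃ U : ℕ → UnitAddTorus d → EuclideanSpace ℝ d,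
      (∀ N, IsSmooth (U N)) ∧ (∀ N, IsDivFree (U N)) ∧ (∀ N, HasZeroMean (U N)) ∧
      (∀ N, eGradNormSq (U N) ≤
        ENNReal.ofReal (4 * Real.pi ^ 2 * ((∫ x, ‖f x‖ ^ 2) / (4 * Real.pi ^ 2 * ν) ^ 2))) ∧
      (∀ N, ∫⁻ x, ‖U N x‖ₑ ^ 2 ≤ ENNReal.ofReal ((∫ x, ‖f x‖ ^ 2) / (4 * Real.pi ^ 2 * ν) ^ 2)) ∧
      (∀ N (a : UnitAddTorus d → EuclideanSpace ℝ d), IsSmooth a → IsDivFree a →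
        (∀ k ∉ (freqBall (d := d) N).erase 0,
          mFourierCoeff (EuclideanSpace.complexify ∘ a) k = 0) →
        ∫ x, (⟪U N x, Literature.Analysis.FunctionSpaces.Torus.convect (U N) a x⟫_ℝ + ν * ⟪U N x, laplacian a x⟫_ℝ +
          ⟪f x, a x⟫_ℝ) = 0) ∧
      ∀ N, ∀ p ∈ G, ∀ (y : UnitAddTorus d) (i : d),
        U N (fun j => p.2.1 j • y (p.1 j) + p.2.2 j) i = (p.2.1 i : ℝ) * U N y (p.1 i) := by
  classical
  choose C hCsymm hCtr hCsupp hCbd hCtest hCsym using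
    fun N : ℕ => exists_symmetric_steady_galerkin_approx (d := d) hν G hG hf hfG N
  refine ⟨fun N => realTrigPoly ((freqBall (d := d) N).erase 0) (C N),
    fun N => isSmooth_realTrigPoly _ _, fun N => isDivFree_realTrigPoly fun k _ => hCtr N k,
    fun N => hasZeroMean_realTrigPoly_of_zero_not_mem (by simp) (C N), fun N => ?_, fun N => ?_,
    fun N a ha hdiv hband => hCtest N a ha hdiv hband, fun N p hp y i => hCsym N p hp y i⟩
  · exact (steady_galerkin_bounds hν (hCsymm N) (hCsupp N) (hCbd N)).1
  · have h := (steady_galerkin_bounds hν (hCsymm N) (hCsupp N) (hCbd N)).2.1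
    have hm : MemLp (realTrigPoly ((freqBall (d := d) N).erase 0) (C N)) 2 volume :=
      memLp_realTrigPoly _ _ 2
    calc ∫⁻ x, ‖realTrigPoly ((freqBall (d := d) N).erase 0) (C N) x‖ₑ ^ 2
        = ENNReal.ofReal (∫ x, ‖realTrigPoly ((freqBall (d := d) N).erase 0) (C N) x‖ ^ 2) := by
          rw [ofReal_integral_eq_lintegral_ofReal (hm.integrable_norm_pow two_ne_zero)
            (ae_of_all _ fun x => by positivity)]
          refine lintegral_congr fun x => ?_
          rw [← ofReal_norm, ← ENNReal.ofReal_pow (norm_nonneg _)]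
      _ ≤ _ := ENNReal.ofReal_le_ofReal h

end Galerkin

end MirrorSteadyExistence

end Summit.AnomalousDissipation.AnomalousDissipation.Theorems
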